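import Summits.HubbardSuperconductivity.HubbardSuperconductivity.Theses.ParityGapRigidity
import Summits.HubbardSuperconductivity.HubbardSuperconductivity.Theorems.JosephsonMirrorJmCuspFreeLayersNotSimple
import Literature.MathematicalPhysics.QuantumLattice.FreeFermionGraphSectorFloor
import HarnessLib

/-!
# Route `ParityGapRigidity` — the `U = 0` calibration of the parity-gap clause (PG)

The crux `GappedWindow` (stmt-HubbardSuperconductivity-2196) of route `ParityGapRigidity` asserts the
existence of a repulsive coupling `U > 0` and a hole doping `δ ∈ (0, 1/2)` at which, uniformly in the
even torus side `L ≥ L₀`, the pure `t' = 0` Hubbard model `hubbardTorus 2 L 1 U` has (PG) a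
one-particle parity (charge) gap `E(N_L+1) + E(N_L-1) - 2 E₀(N_L, S^z = 0) ≥ 2Δ > 0`,
`N_L = 2⌊(1-δ)L²/2⌋`, together with four further clauses; the route's kill criterion
`NoUniformParityGap` (stmt-HubbardSuperconductivity-2198) is the pointwise negation of (PG) at every
`U > 0`, `δ ∈ (0, 1/2)`.  Neither is decidable today (the parity gap of the interacting model along all
large even `L` is the open question whether the two-dimensional Hubbard model is somewhere a fully
gapped superconductor / paired insulator).

This file machine-checks the one decidable point of the coupling axis, the FREE point `U = 0`:

* `planeWaveSite_orthonormal`, `negAdj_mulVec_planeWaveSite` — the normalised characters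
  `x ↦ L⁻¹ χ_k(x)` are an orthonormal family of eigenmodes of minus the adjacency matrix of the
  fermionic torus `(ℤ/Lℤ)²` with levels the band function `ε_L(k) = -2(cos(2πk₁/L) + cos(2πk₂/L))`
  (`L ≥ 3`);
* `groundEnergy_free_le_fermiSum` — hence (two-spin Fermi seas, `fermiSea_spec`) for all finite
  momentum sets `F↑, F↓` the free `(|F↑| + |F↓|)`-particle ground energy is at most
  `Σ_{F↑} ε_L + Σ_{F↓} ε_L`;
* `parityGap_free_le_zero_of_openShell` — at an OPEN shell, `#{ε_L < μ} < n < #{ε_L ≤ μ}`, the free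
  parity gap about the `(2n, S^z = 0)` floor is `≤ 0`: fill a Fermi set `F` of `n` levels in both
  spins (`E₀(2n, 0) = 2 Σ_F ε_L`, `minEnergyOn_szSector_free_eq`), add one electron in a further shell
  momentum (`E(2n+1) ≤ 2 Σ_F ε_L + μ`) or remove one from a shell momentum of `F`
  (`E(2n-1) ≤ 2 Σ_F ε_L - μ`);
* `exists_even_ge_parityGap_free_le_zero` — for every `δ ∈ (0, 1)` and every `L₀` some even `L ≥ L₀`
  has an open shell at `n_L = ⌊(1-δ)L²/2⌋` (the tree's `openShell_of_mod_four_ne_one`,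
  `exists_even_ge_floor_mod_four_ne_one`, landed for route `JosephsonMirror`), hence free parity gap
  `≤ 0` at `N_L`;
* `not_uniformParityGap_free` — so the (PG) clause of `GappedWindow` with `U := 0` is FALSE at every
  doping `δ ∈ (0, 1)`; `gappedWindow_parityGap_clause_fails_at_zero_coupling` — in particular on the
  crux's window `(0, 1/2)`, in the verbatim vocabulary of the route file; and
  `gappedWindow_body_false_at_zero_coupling` — the whole body of `GappedWindow` (all five clauses
  verbatim) with the coupling frozen at `U = 0` is false: the free point is not a window.

Reading for the two items.  (i) The hypothesis `0 < U` of `GappedWindow` is load-bearing: the free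
point is not a window, and no proof of (PG) at a point `(U, δ)` can run by continuity from `U = 0`
along all large even `L` — the interaction has to open a gap that is exactly `0` at `U = 0` for
infinitely many even `L` (non-perturbative in every `L`-uniform sense, as the route's barrier note
`WeakCouplingCeiling` anticipates).  (ii) The conclusion of the kill criterion `NoUniformParityGap`
HOLDS at `U = 0` for every `δ ∈ (0, 1/2)` (`noUniformParityGap_clause_holds_at_zero_coupling`): the
refuter instrument of the route (parity-gap maps `L ↦ E(N_L±1) - hull`) is calibrated at the free
point, where it must read `0` on the open-shell subsequence.

Sources: J. Bardeen, L. N. Cooper, J. R. Schrieffer, Phys. Rev. 108 (1957) 1175 §II (Fermi seas);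
K. A. Matveev, A. I. Larkin, PRL 78 (1997) 3749 (the parity gap); E. H. Lieb, PRL 62 (1989) 1201
(the sectors `(a, b)`).  Folklore finite-dimensional statements; no definitions, no named facts.

## Mathlib / tree search

Tree (REUSED): `fermiSea_spec`, `hubbardOneBody_orb_orb` (free floor on a graph),
`minEnergyOn_szSector_free_eq`, `exists_two_fermiSets` (`FreeFermionSectorGroundStates`),
`sum_ite_torusGraph_adj_torusChar`, `torusBand`, `FermionTorus.sum_eq_sum_torusSite`
(`HubbardFreePropagator`), `torusChar_sub_left`, `sum_torusChar_right` (`TorusFourierProofs`),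
`LiebThm1.groundEnergy_le_re_expect` (variational principle), `openShell_of_mod_four_ne_one`,
`exists_even_ge_floor_mod_four_ne_one` (`JosephsonMirrorJmCuspFreeLayersNotSimple`).
Mathlib: `Finset.exists_mem_notMem_of_card_lt_card`, `Finset.sum_insert`, `Finset.sum_erase_add`.
-/

-- the mandated namespace `Summit.<Summit>.<Problem>.Theorems` repeats `HubbardSuperconductivity`
-- (single-problem summit, D-0017), which the `dupNamespace` linter flags on every declaration
set_option linter.dupNamespace false

noncomputable section

namespace Summit.HubbardSuperconductivity.HubbardSuperconductivity.Theorems.ParityGapRigidityFree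

open Matrix Finset Literature.MathematicalPhysics.QuantumLattice Literature.Probability.LatticeModels
open scoped ComplexConjugate

section Torus

variable {L : ℕ} [NeZero L]

/-! ### Normalised plane waves on the sites of the fermionic torus -/

/-- **Orthonormality of the normalised characters** on the sites of the fermionic torus `(ℤ/Lℤ)²`:
`Σ_x conj(L⁻¹ χ_k(x)) · L⁻¹ χ_l(x) = δ_{kl}` (orthogonality of characters, `sum_torusChar_right`).
[folklore] -/
theorem planeWaveSite_orthonormal (k l : TorusSite 2 L) :
    star (fun x : FermionTorus 2 L => ((L : ℂ))⁻¹ * torusChar k x.toTorusSite) ⬝ᵥ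
        (fun x : FermionTorus 2 L => ((L : ℂ))⁻¹ * torusChar l x.toTorusSite) =
      if k = l then 1 else 0 := by
  classical
  have hL0 : (L : ℂ) ≠ 0 := Nat.cast_ne_zero.2 (NeZero.ne L)
  have hterm : ∀ x : FermionTorus 2 L,
      star (((L : ℂ))⁻¹ * torusChar k x.toTorusSite) * (((L : ℂ))⁻¹ * torusChar l x.toTorusSite) =
        ((L : ℂ))⁻¹ * ((L : ℂ))⁻¹ * torusChar (l - k) x.toTorusSite := by
    intro x
    rw [torusChar_sub_left, Complex.star_def, map_mul, map_inv₀, Complex.conj_natCast]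
    ring
  simp only [dotProduct, Pi.star_apply, hterm]
  rw [← Finset.mul_sum, FermionTorus.sum_eq_sum_torusSite]
  simp only [FermionTorus.toTorusSite_ofTorusSite]
  rw [sum_torusChar_right]
  by_cases hkl : k = l
  · rw [if_pos (sub_eq_zero.2 hkl.symm), if_pos hkl]
    field_simp
  · rw [if_neg (fun h => hkl (sub_eq_zero.1 h).symm), if_neg hkl, mul_zero]

/-- **The normalised characters diagonalise minus the adjacency matrix of the fermionic torus**
(`L ≥ 3`): `(-adj) (L⁻¹ χ_k) = ε_L(k) · (L⁻¹ χ_k)` with the band function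
`ε_L(k) = -2 Σᵢ cos(2πkᵢ/L)` (`sum_ite_torusGraph_adj_torusChar`). [folklore] -/
theorem negAdj_mulVec_planeWaveSite (hL : 3 ≤ L) (k : TorusSite 2 L) :
    (Matrix.of fun x y : FermionTorus 2 L =>
        if (fermionTorusGraph 2 L).Adj x y then (-1 : ℂ) else 0) *ᵥ
        (fun x : FermionTorus 2 L => ((L : ℂ))⁻¹ * torusChar k x.toTorusSite) =
      ((torusBand L k : ℝ) : ℂ) • fun x : FermionTorus 2 L => ((L : ℂ))⁻¹ * torusChar k x.toTorusSite := by
  classical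
  funext x
  simp only [Matrix.mulVec, dotProduct, Matrix.of_apply, Pi.smul_apply, smul_eq_mul]
  have hterm : ∀ y : FermionTorus 2 L,
      (if (fermionTorusGraph 2 L).Adj x y then (-1 : ℂ) else 0) * (((L : ℂ))⁻¹ * torusChar k y.toTorusSite) =
        -((L : ℂ))⁻¹ * (if (torusGraph 2 L).Adj x.toTorusSite y.toTorusSite then torusChar k y.toTorusSite else 0) := by
    intro y
    by_cases h : (torusGraph 2 L).Adj x.toTorusSite y.toTorusSite
    · rw [if_pos ((fermionTorusGraph_adj x y).2 h), if_pos h]; ring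
    · rw [if_neg (fun h' => h ((fermionTorusGraph_adj x y).1 h')), if_neg h]; ring
  simp only [hterm]
  rw [← Finset.mul_sum, FermionTorus.sum_eq_sum_torusSite]
  simp only [FermionTorus.toTorusSite_ofTorusSite]
  rw [sum_ite_torusGraph_adj_torusChar hL k x.toTorusSite]
  unfold torusBand
  push_cast
  ring

/-! ### Free sector energies from above: two-spin Fermi seas -/

/-- **Two-spin Fermi seas bound the free sector energies from above** (`L ≥ 3`): for all finite
momentum sets `F↑, F↓ ⊆ (ℤ/Lℤ)²`, the free `(|F↑| + |F↓|)`-particle ground energy of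
`hubbardTorus 2 L 1 0` is at most `Σ_{F↑} ε_L + Σ_{F↓} ε_L` — the Slater state filling the `↑`-plane
waves of `F↑` and the `↓`-plane waves of `F↓` is a unit `(|F↑| + |F↓|)`-particle eigenvector with that
eigenvalue (`fermiSea_spec`), and the ground energy is a Rayleigh infimum
(`LiebThm1.groundEnergy_le_re_expect`). Bardeen–Cooper–Schrieffer (1957) §II. [folklore] -/
theorem groundEnergy_free_le_fermiSum (hL : 3 ≤ L) (Fu Fd : Finset (TorusSite 2 L)) :
    groundEnergy (hubbardTorus 2 L 1 0) (Fu.card + Fd.card) ≤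
      ∑ k ∈ Fu, torusBand L k + ∑ k ∈ Fd, torusBand L k := by
  classical
  set v : TorusSite 2 L → FermionTorus 2 L → ℂ :=
    fun k x => ((L : ℂ))⁻¹ * torusChar k x.toTorusSite with hvdef
  set w : TorusSite 2 L × Fin 2 → Orb (FermionTorus 2 L) → ℂ :=
    fun p o => if (ofLex o).2 = p.2 then v p.1 (ofLex o).1 else 0 with hwdef
  have hw : ∀ p o, w p o = if (ofLex o).2 = p.2 then v p.1 (ofLex o).1 else 0 := fun p o => rfl
  obtain ⟨hmem, h1, hH⟩ := fermiSea_spec (fermionTorusGraph 2 L)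
    (HubbardBandBottom.hubbardOneBody_orb_orb (fermionTorusGraph 2 L)) v (torusBand L)
    (fun k l => planeWaveSite_orthonormal k l) (fun k => negAdj_mulVec_planeWaveSite hL k) w hw Fu Fd
  have hN := ((mem_szSector_iff _ _ _).1 hmem).1
  have h := LiebThm1.groundEnergy_le_re_expect (hubbardTorus 2 L 1 0) hN h1
  have hHt : hubbardTorus 2 L 1 0 = hamiltonian (fermionTorusGraph 2 L) 1 0 := rfl
  rw [Literature.MathematicalPhysics.QuantumLattice.expect, hHt, hH, dotProduct_smul, h1, smul_eq_mul, mul_one,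
    Complex.ofReal_re] at h
  exact h

/-! ### The free parity gap vanishes at an open shell -/

/-- **At an open shell the free parity gap is `≤ 0`.** For `L ≥ 3`, a level `μ` and a number `n` of
electrons per spin with `#{ε_L < μ} < n < #{ε_L ≤ μ}` (the shell `{ε_L = μ}` is partially filled):
`E⁰(2n+1) + E⁰(2n-1) - 2 E⁰₀(2n, S^z = 0) ≤ 0` for the free torus `hubbardTorus 2 L 1 0`
(`groundEnergy` over all spins for the odd sectors, `minEnergyOn szSector` for the even one, exactly
as in the (PG) clause of `GappedWindow`).  Proof: a Fermi set `F` of `n` levels has floor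
`E⁰₀(2n, 0) = 2 Σ_F ε_L` (`minEnergyOn_szSector_free_eq`); adding an `↑`-electron in a shell momentum
`q ∉ F` costs `μ`, removing a `↓`-electron from a shell momentum `q' ∈ F` gains `μ`
(`groundEnergy_free_le_fermiSum`).  (The bound is attained: the free parity gap at an open shell is
exactly `0`.) Bardeen–Cooper–Schrieffer (1957) §II; Matveev–Larkin (1997). [folklore] -/
theorem parityGap_free_le_zero_of_openShell (hL : 3 ≤ L) (μ : ℝ) (n : ℕ)
    (hlt : (univ.filter fun k : TorusSite 2 L => torusBand L k < μ).card < n)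
    (hgt : n < (univ.filter fun k : TorusSite 2 L => torusBand L k ≤ μ).card) :
    groundEnergy (hubbardTorus 2 L 1 0) (2 * n + 1) + groundEnergy (hubbardTorus 2 L 1 0) (2 * n - 1) -
        2 * (hubbardTorus 2 L 1 0).minEnergyOn (szSector (Λ := FermionTorus 2 L) (2 * n) 0) ≤ 0 := by
  classical
  obtain ⟨F, F', hFc, -, hF, hF', hG, -, q, hq', hq⟩ :=
    exists_two_fermiSets (torusBand L) μ n hlt hgt
  -- the momentum `q ∉ F` added on the `2n + 1` side lies on the shell
  have hεq : torusBand L q = μ := le_antisymm (hG q hq') (hF' q hq)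
  -- a shell momentum `q' ∈ F`, removed on the `2n - 1` side
  obtain ⟨q', hq'F, hq'B⟩ : ∃ q' ∈ F, q' ∉ (univ.filter fun k : TorusSite 2 L => torusBand L k < μ) := by
    apply Finset.exists_mem_notMem_of_card_lt_card
    rw [hFc]
    exact hlt
  have hεq' : torusBand L q' = μ := by
    have h1 : ¬ torusBand L q' < μ := fun h => hq'B (mem_filter.2 ⟨mem_univ _, h⟩)
    exact le_antisymm (hF q' hq'F) (not_lt.1 h1)
  have hn1 : 1 ≤ n := by omega
  -- `E⁰(2n+1) ≤ (ε_q + Σ_F ε) + Σ_F ε`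
  have hplus := groundEnergy_free_le_fermiSum hL (insert q F) F
  rw [card_insert_of_notMem hq, sum_insert hq, hFc,
    show n + 1 + n = 2 * n + 1 by ring] at hplus
  -- `E⁰(2n-1) ≤ Σ_F ε + (Σ_F ε - ε_{q'})`
  have hminus := groundEnergy_free_le_fermiSum hL F (F.erase q')
  rw [card_erase_of_mem hq'F, hFc, show n + (n - 1) = 2 * n - 1 by omega] at hminus
  have hsum_erase : ∑ k ∈ F.erase q', torusBand L k = ∑ k ∈ F, torusBand L k - torusBand L q' := by
    rw [← Finset.sum_erase_add F _ hq'F]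
    ring
  rw [hsum_erase] at hminus
  -- `E⁰₀(2n, 0) = 2 Σ_F ε`
  have hfloor := minEnergyOn_szSector_free_eq hL F μ hF hF'
  rw [hFc] at hfloor
  rw [hfloor]
  linarith

end Torus

/-! ### Along even `L` the free parity gap at `N_L = 2⌊(1-δ)L²/2⌋` vanishes infinitely often -/

/-- **At every doping the free parity gap is `≤ 0` for infinitely many even sides.** For
`0 < δ < 1` and every `L₀` there is an even `L ≥ L₀` at which the free torus `hubbardTorus 2 L 1 0`
has `E⁰(N_L+1) + E⁰(N_L-1) - 2 E⁰₀(N_L, S^z = 0) ≤ 0`, `N_L = 2⌊(1-δ)L²/2⌋`: the shell number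
`n_L = ⌊(1-δ)L²/2⌋` is `≢ 1 (mod 4)` for some `L ∈ {2m, 4m, 6m, 8m}`
(`exists_even_ge_floor_mod_four_ne_one`), such a shell of the even torus is open
(`openShell_of_mod_four_ne_one`), and an open shell has parity gap `≤ 0`
(`parityGap_free_le_zero_of_openShell`). [folklore] -/
theorem exists_even_ge_parityGap_free_le_zero {δ : ℝ} (hδ0 : 0 < δ) (hδ1 : δ < 1) (L₀ : ℕ) :
    ∃ L : ℕ, Even L ∧ L₀ ≤ L ∧
      groundEnergy (hubbardTorus 2 L 1 0) (2 * ⌊(1 - δ) * (L : ℝ) ^ 2 / 2⌋₊ + 1) +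
          groundEnergy (hubbardTorus 2 L 1 0) (2 * ⌊(1 - δ) * (L : ℝ) ^ 2 / 2⌋₊ - 1) -
        2 * (hubbardTorus 2 L 1 0).minEnergyOn
          (szSector (Λ := FermionTorus 2 L) (2 * ⌊(1 - δ) * (L : ℝ) ^ 2 / 2⌋₊) 0) ≤ 0 := by
  have hx : 0 < 1 - δ := by linarith
  -- `L` even, large, with `n_L ≢ 1 (mod 4)`
  obtain ⟨L, hLe, hLge, hL4, hmod⟩ :=
    JosephsonMirror.exists_even_ge_floor_mod_four_ne_one hx.le (max L₀ (⌈2 / (1 - δ)⌉₊))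
  haveI : NeZero L := ⟨by omega⟩
  have hL0 : L₀ ≤ L := le_trans (le_max_left _ _) hLge
  have hLc : ⌈2 / (1 - δ)⌉₊ ≤ L := le_trans (le_max_right _ _) hLge
  set n : ℕ := ⌊(1 - δ) * (L : ℝ) ^ 2 / 2⌋₊ with hn
  have hLr : (2 / (1 - δ) : ℝ) ≤ L := le_trans (Nat.le_ceil _) (by exact_mod_cast hLc)
  have hL1 : (1 : ℝ) ≤ L := by exact_mod_cast (show 1 ≤ L by omega)
  have hn1 : 1 ≤ n := by
    refine Nat.le_floor ?_
    rw [Nat.cast_one]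
    have h2 : 2 ≤ (1 - δ) * L := by
      rw [div_le_iff₀ hx] at hLr; linarith
    have : (1 - δ) * L ≤ (1 - δ) * (L : ℝ) ^ 2 := by
      rw [sq]; exact mul_le_mul_of_nonneg_left (le_mul_of_one_le_left (by positivity) hL1) hx.le
    linarith
  have hnL : 2 * n < L ^ 2 := by
    have h1 : (n : ℝ) ≤ (1 - δ) * (L : ℝ) ^ 2 / 2 := Nat.floor_le (by positivity)
    have h2 : (1 - δ) * (L : ℝ) ^ 2 / 2 < (L : ℝ) ^ 2 / 2 := by
      rw [div_lt_div_iff_of_pos_right two_pos]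
      have hL2 : (0 : ℝ) < (L : ℝ) ^ 2 := by positivity
      nlinarith
    have h3 : (2 * n : ℝ) < (L : ℝ) ^ 2 := by linarith
    exact_mod_cast h3
  obtain ⟨hlt, hgt⟩ := JosephsonMirror.openShell_of_mod_four_ne_one hLe hn1 hnL hmod
  exact ⟨L, hLe, hL0, parityGap_free_le_zero_of_openShell (by omega) _ n hlt hgt⟩

/-- **The free torus has no uniform parity gap at any doping.** For `0 < δ < 1` there are NO `Δ > 0`,
`L₀` with `2Δ ≤ E⁰(N_L+1) + E⁰(N_L-1) - 2 E⁰₀(N_L, S^z = 0)` for all even `L ≥ L₀` — the parity-gap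
clause (PG) of `GappedWindow` with the coupling set to `U = 0`, verbatim otherwise. [folklore] -/
theorem not_uniformParityGap_free {δ : ℝ} (hδ0 : 0 < δ) (hδ1 : δ < 1) :
    ¬ ∃ Δ : ℝ, 0 < Δ ∧ ∃ L₀ : ℕ, ∀ L ≥ L₀, Even L → ∀ Hm, Hm = hubbardTorus 2 L 1 0 →
      2 * Δ ≤ groundEnergy Hm (2 * ⌊(1 - δ) * (L : ℝ) ^ 2 / 2⌋₊ + 1) +
        groundEnergy Hm (2 * ⌊(1 - δ) * (L : ℝ) ^ 2 / 2⌋₊ - 1) -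
          2 * Matrix.minEnergyOn Hm (szSector (2 * ⌊(1 - δ) * (L : ℝ) ^ 2 / 2⌋₊) 0) := by
  rintro ⟨Δ, hΔ, L₀, h⟩
  obtain ⟨L, hLe, hL0, hPG⟩ := exists_even_ge_parityGap_free_le_zero hδ0 hδ1 L₀
  have h' := h L hL0 hLe _ rfl
  linarith

/-! ### The two items of route `ParityGapRigidity` at the free point -/

/-- **`U = 0` calibration of the crux `GappedWindow` (stmt-HubbardSuperconductivity-2196): its
parity-gap clause (PG) FAILS at zero coupling on the whole doping window.** With the hypothesis
`0 < U` of `Theses.ParityGapRigidity.GappedWindow` replaced by `U = 0`, the first conjunct (PG) is false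
for every `δ ∈ (0, 1/2)` (stated in the route file's vocabulary).  So `0 < U` is load-bearing, and a
proof of (PG) at any `(U, δ)` has to open, uniformly in all large even `L`, a gap that vanishes
identically at `U = 0` along a subsequence of even `L`. [folklore] -/
theorem gappedWindow_parityGap_clause_fails_at_zero_coupling :
    ∀ (U δ : ℝ), U = 0 → δ ∈ Set.Ioo (0 : ℝ) (1 / 2) →
      ¬ (∃ Δ : ℝ, 0 < Δ ∧ ∃ L₀ : ℕ, ∀ L ≥ L₀, Even L → ∀ Hm, Hm = Literature.MathematicalPhysics.QuantumLattice.hubbardTorus 2 L 1 U → 2 * Δ ≤ Literature.MathematicalPhysics.QuantumLattice.groundEnergy Hm (2 * ⌊(1 - δ) * (L : ℝ) ^ 2 / 2⌋₊ + 1) + Literature.MathematicalPhysics.QuantumLattice.groundEnergy Hm (2 * ⌊(1 - δ) * (L : ℝ) ^ 2 / 2⌋₊ - 1) - 2 * Matrix.minEnergyOn Hm (Literature.MathematicalPhysics.QuantumLattice.szSector (2 * ⌊(1 - δ) * (L : ℝ) ^ 2 / 2⌋₊) 0)) := by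
  rintro U δ rfl hδ
  exact not_uniformParityGap_free hδ.1 (by linarith [hδ.2])

/-- **`U = 0` calibration of the kill criterion `NoUniformParityGap` (stmt-HubbardSuperconductivity-2198):
its conclusion HOLDS at zero coupling.** `Theses.ParityGapRigidity.NoUniformParityGap` reads
`∀ U δ, 0 < U → δ ∈ (0, 1/2) → ¬ (PG at (U, δ))`; with `0 < U` replaced by `U = 0` it is a theorem.
The refuter instrument of the route (maps of the parity gap `E(N_L±1) - hull` along even `L`) is thus
calibrated at the free point, where it reads `≤ 0` on the open-shell subsequence
(`exists_even_ge_parityGap_free_le_zero`). [folklore] -/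
theorem noUniformParityGap_clause_holds_at_zero_coupling :
    ∀ (U δ : ℝ), U = 0 → δ ∈ Set.Ioo (0 : ℝ) (1 / 2) → ¬ (∃ Δ : ℝ, 0 < Δ ∧ ∃ L₀ : ℕ, ∀ L ≥ L₀, Even L → ∀ Hm, Hm = Literature.MathematicalPhysics.QuantumLattice.hubbardTorus 2 L 1 U → 2 * Δ ≤ Literature.MathematicalPhysics.QuantumLattice.groundEnergy Hm (2 * ⌊(1 - δ) * (L : ℝ) ^ 2 / 2⌋₊ + 1) + Literature.MathematicalPhysics.QuantumLattice.groundEnergy Hm (2 * ⌊(1 - δ) * (L : ℝ) ^ 2 / 2⌋₊ - 1) - 2 * Matrix.minEnergyOn Hm (Literature.MathematicalPhysics.QuantumLattice.szSector (2 * ⌊(1 - δ) * (L : ℝ) ^ 2 / 2⌋₊) 0)) :=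
  gappedWindow_parityGap_clause_fails_at_zero_coupling

/-- **The free point is not a window.** The body of `Theses.ParityGapRigidity.GappedWindow` with the
coupling frozen at `U = 0` — `∃ δ ∈ (0, 1/2)` with (PG) ∧ (H2) ∧ (H3) ∧ (H4) ∧ (DOM) for the FREE torus
family `hubbardTorus 2 L 1 0`, every clause verbatim — is FALSE, because (PG) already fails at every
doping (`not_uniformParityGap_free`).  Tightness reading for the crux: whatever `(U, δ)` witnesses
`GappedWindow`, it does so through the interaction; the statement has no free-fermion instance to
deform from. [folklore] -/
theorem gappedWindow_body_false_at_zero_coupling :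
    ¬ ∃ δ ∈ Set.Ioo (0 : ℝ) (1 / 2), (∃ Δ : ℝ, 0 < Δ ∧ ∃ L₀ : ℕ, ∀ L ≥ L₀, Even L → ∀ Hm, Hm = Literature.MathematicalPhysics.QuantumLattice.hubbardTorus 2 L 1 0 → 2 * Δ ≤ Literature.MathematicalPhysics.QuantumLattice.groundEnergy Hm (2 * ⌊(1 - δ) * (L : ℝ) ^ 2 / 2⌋₊ + 1) + Literature.MathematicalPhysics.QuantumLattice.groundEnergy Hm (2 * ⌊(1 - δ) * (L : ℝ) ^ 2 / 2⌋₊ - 1) - 2 * Matrix.minEnergyOn Hm (Literature.MathematicalPhysics.QuantumLattice.szSector (2 * ⌊(1 - δ) * (L : ℝ) ^ 2 / 2⌋₊) 0)) ∧ (∃ C : ℝ, ∃ L₀ : ℕ, ∀ L ≥ L₀, Even L → ∀ Hm, Hm = Literature.MathematicalPhysics.QuantumLattice.hubbardTorus 2 L 1 0 → ∀ ψ, Literature.MathematicalPhysics.QuantumLattice.IsGroundStateInSector Hm (2 * ⌊(1 - δ) * (L : ℝ) ^ 2 / 2⌋₊) 0 ψ → star ψ ⬝ᵥ ψ = 1 →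 ∀ a : Literature.MathematicalPhysics.QuantumLattice.Orb (Literature.MathematicalPhysics.QuantumLattice.FermionTorus 2 L) × Literature.MathematicalPhysics.QuantumLattice.Orb (Literature.MathematicalPhysics.QuantumLattice.FermionTorus 2 L) → ℂ, (∀ p, ‖a p‖ ≤ 1) → (∀ p, a p ≠ 0 → Literature.MathematicalPhysics.QuantumLattice.torusDist (ofLex p.1).1.toTorusSite (ofLex p.2).1.toTorusSite ≤ 1) → (Literature.MathematicalPhysics.QuantumLattice.expect (Matrix.conjTranspose (∑ p, a p • (Literature.MathematicalPhysics.QuantumLattice.creation p.1 * Literature.MathematicalPhysics.QuantumLattice.annihilation p.2)) * (∑ p, a p • (Literature.MathematicalPhysics.QuantumLattice.creation p.1 * Literature.MathematicalPhysics.QuantumLattice.annihilation p.2))) ψ).re - ‖Literature.MathematicalPhysics.QuantumLattice.expect (∑ p, a p • (Literature.MathematicalPhysics.QuantumLattice.creation p.1 * Literature.MathematicalPhysics.QuantumLattice.annihilation p.2)) ψ‖ ^ 2 ≤ C * (L : ℝ) ^ 2) ∧ (∃ c : ℝ, 0 < c ∧ ∃ D L₀ : ℕ, ∀ L ≥ L₀,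 Even L → ∀ Hm, Hm = Literature.MathematicalPhysics.QuantumLattice.hubbardTorus 2 L 1 0 → ∀ V : Submodule ℂ (Literature.MathematicalPhysics.QuantumLattice.Fock (Literature.MathematicalPhysics.QuantumLattice.Orb (Literature.MathematicalPhysics.QuantumLattice.FermionTorus 2 L))), V ≤ Literature.MathematicalPhysics.QuantumLattice.szSector (2 * ⌊(1 - δ) * (L : ℝ) ^ 2 / 2⌋₊) 0 → (∀ φ ∈ V, (star φ ⬝ᵥ Matrix.mulVec Hm φ).re ≤ (Matrix.minEnergyOn Hm (Literature.MathematicalPhysics.QuantumLattice.szSector (2 * ⌊(1 - δ) * (L : ℝ) ^ 2 / 2⌋₊) 0) + c / (L : ℝ)) * (star φ ⬝ᵥ φ).re) → Module.finrank ℂ V ≤ D) ∧ (∃ C : ℝ, ∃ L₀ : ℕ, ∀ L ≥ L₀, Even L → ∀ Hm, Hm = Literature.MathematicalPhysics.QuantumLattice.hubbardTorus 2 L 1 0 → ∀ (E : ℕ → ℝ) (n : ℕ), E = Literature.MathematicalPhysics.QuantumLattice.groundEnergy Hm → n = 2 * ⌊(1 - δ) * (L : ℝ) ^ 2 / 2⌋₊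 → E (n + 2) - (E n + E (n + 4)) / 2 ≤ C / (L : ℝ) ^ 2 ∧ E (n - 2) - (E n + E (n - 4)) / 2 ≤ C / (L : ℝ) ^ 2) ∧ (∃ κ : ℝ, 0 < κ ∧ ∃ L₀ : ℕ, ∀ (L : ℕ) [NeZero L], L₀ ≤ L → Even L → ∀ Hm, Hm = Literature.MathematicalPhysics.QuantumLattice.hubbardTorus 2 L 1 0 → ∀ ψ, Literature.MathematicalPhysics.QuantumLattice.IsGroundStateInSector Hm (2 * ⌊(1 - δ) * (L : ℝ) ^ 2 / 2⌋₊) 0 ψ → star ψ ⬝ᵥ ψ = 1 → ∀ v : Literature.MathematicalPhysics.QuantumLattice.Orb (Literature.MathematicalPhysics.QuantumLattice.FermionTorus 2 L) × Literature.MathematicalPhysics.QuantumLattice.Orb (Literature.MathematicalPhysics.QuantumLattice.FermionTorus 2 L) → ℂ, star v ⬝ᵥ v = 1 → κ * (L : ℝ) ^ 2 * (star v ⬝ᵥ Matrix.mulVec (Literature.MathematicalPhysics.QuantumLattice.twoParticleRDM ψ) v).re ≤ (Literature.MathematicalPhysics.QuantumLattice.expect (Matrix.conjTranspose (Literature.MathematicalPhysics.QuantumLattice.pairField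 Literature.MathematicalPhysics.QuantumLattice.dWaveFormFactor L) * Literature.MathematicalPhysics.QuantumLattice.pairField Literature.MathematicalPhysics.QuantumLattice.dWaveFormFactor L) ψ).re) := by
  rintro ⟨δ, hδ, hPG, -⟩
  exact not_uniformParityGap_free hδ.1 (by linarith [hδ.2]) hPG

end Summit.HubbardSuperconductivity.HubbardSuperconductivity.Theorems.ParityGapRigidityFree

end
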